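import Summits.Ventures.AbcShadow.SH02.Kill7841A

/-!
# Venture AbcShadow — SH-02 kernel run at `ℓ = 7841` (k odd, `c = -158`), part B (assembly)

HONEST FRAMING. Kernel-certificate file of the work-bound cell `abc-shadow` (typer seat `abc-shadow-typ-2`); no
Diophantine statement, no claim on abc or on any summit, no side on IUT. Each `kill7841_chunk*` theorem is a
`decide +kernel` evaluation of `checkRange` (`SH02/Witness.lean`): for every `w` in the stated range, the
Frey–Hellegouarch curve `G_{w,1} : Y² = X³ + 2wX² + (w² − 73^3)X` over `𝔽_7841` carries a point `P` (found by
the checker: least `x ≥ 1` with `f(x)` a nonzero square, `y` by Tonelli–Shanks, re-verified) with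
`8000 · P ≠ O` under Mathlib's group law, hence `#G_{w,1}(𝔽_7841) ≠ 8000 = 7841 + 1 − (-158)`, i.e.
`a_7841(G_{w,1}) ≠ -158` — the cell's COMPUTED record (inv-6 K4-73, crit-1 j319553, third path
97fd313139c017bc) re-derived INSIDE the Lean kernel. Only `w ≤ 3920 = ⌊ℓ/2⌋` is run (`G_{−w} ≅ G_w`,
`natCard_bs23Frey_neg`, `√−1 = 7643` in `𝔽_7841`). The last part assembles `KillCert 7841 1 (-158)` (`killCert_7841`): the kill-prime proposition of `SH02/KillData.lean` now holds UNCONDITIONALLY (Hasse bound from the tree′s proved theorem).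
-/

namespace Summit.Ventures.AbcShadow

/-- Kernel run: the annihilation-witness check passes for `2000 ≤ w < 3000` at `ℓ = 7841` (`v = 1`,
`N = 8000`). [folklore] -/
theorem kill7841_chunk2 : checkRange 7841 1 8000 245 5 73 30 2000 1000 = true := by
  decide +kernel

/-- Kernel run: the annihilation-witness check passes for `3000 ≤ w < 3921` at `ℓ = 7841` (`v = 1`,
`N = 8000`). [folklore] -/
theorem kill7841_chunk3 : checkRange 7841 1 8000 245 5 73 30 3000 921 = true := by
  decide +kernel

/-- **All `w ≤ ⌊7841/2⌋` pass the annihilation-witness check** (the 4 kernel chunks glued). [folklore] -/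
theorem checkW_half_7841 : ∀ w : ℕ, w ≤ 7841 / 2 → checkW 7841 1 8000 245 5 73 30 w = true := by
  intro w hw
  have hhalf : 7841 / 2 = 3920 := rfl
  rw [hhalf] at hw
  rcases Nat.lt_or_ge w 1000 with h0 | h0
  · exact checkRange_sound 1000 kill7841_chunk0 w (by omega) (by omega)
  rcases Nat.lt_or_ge w 2000 with h1 | h1
  · exact checkRange_sound 1000 kill7841_chunk1 w (by omega) (by omega)
  rcases Nat.lt_or_ge w 3000 with h2 | h2
  · exact checkRange_sound 1000 kill7841_chunk2 w (by omega) (by omega)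
  exact checkRange_sound 921 kill7841_chunk3 w (by omega) (by omega)

/-- **KILL PRIME `ℓ = 7841` CERTIFIED IN THE KERNEL**: `KillCert 7841 1 (-158)` — `7841` prime, `(73/7841) = −1`,
`a_7841(2336a1) = a_7841(2336b1) = -158` (`SH02/TraceCount.lean`), every `a ∈ S_7841` has `a ≠ -158` (the chunks above,
both halves by `w ↦ −w`) and `|a − (-158)| ≤ 178 + 158 < 1000` (Hasse, proved in the tree). No hypothesis remains.
[folklore] -/
theorem killCert_7841 : KillCert 7841 1 (-158) := by
  haveI : Fact (Nat.Prime 7841) := ⟨prime_7841⟩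
  exact killCert_of_kernel 178 (by decide) (by decide) not_isSquare_73_7841 sqrtNegOne_7841 apTrace_e2336a1_7841 apTrace_e2336b1_7841
    (by norm_num) checkW_half_7841 (by norm_num) (by norm_num)

end Summit.Ventures.AbcShadow
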